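import Summits.BirchSwinnertonDyer.BirchSwinnertonDyer.Theorems.KimAtThreeDeepLowerOffStratumResidue
import Summits.BirchSwinnertonDyer.BirchSwinnertonDyer.Theses.SignedLowerHalves
import Summits.BirchSwinnertonDyer.Rank1Residual.X11a.Cells
import Literature.NumberTheory.EllipticCurves.Rank1Residual.Typed.X11Three
import Literature.NumberTheory.EllipticCurves.ZywinaCMImageProofs
import Literature.NumberTheory.EllipticCurves.NonEisensteinPrimeOfSurjective
import HarnessLib

/-!
# Route `KimAtThreeKolyvagin` (rung W2), crux `DeepLowerAtThreeOffKatoStratum` (item 19679), registered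
# stub `stub_nonAdditive`: its two CORNER lower-half families keyed BY NAME to rung K3 (the closed leaf
# `SignedSupersingular` / the cruxes of route `SignedLowerHalves`) and to corner X11a's `p = 3` sub-cell
# target (`X11a.TargetThree`, cell b2b-bsdres)

Cell `bsd-addord`, seat `bsd-addord-w2-acc2` (PROGRAMME PART 1b, ACCEL-LIST row (2): «by-name sockets»),
gen 3; item `stmt-BirchSwinnertonDyer-19679` (BC3 skeleton `DeepLowerAtThreeOffKatoStratum_birth.lean`,
sha16 `e575d03075635394`; the owner w2-c2 assembles via `DeepLowerAtThreeOffKatoStratum_of` — its current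
assembly `KimAtThreeDeepLowerOffKatoStratumAssemblyEnd.deepLowerAtThreeOffKatoStratum_of_facts_of_residuals_end`
DISPLAYS, on the non-additive rows, exactly the two anonymous families re-keyed here). Sequel to
`KimAtThreeDeepLowerOffStratumResidue` (gen 2, ★★: the stub VERBATIM ⟸ eight named facts + (L_ss) + (L_m) +
(TD)). Theorems only; no definition, no named fact asserted, no `sorry`; every open input stays a DISPLAYED
hypothesis — but now a hypothesis that IS a registered ladder object with its own route and seats, not an
anonymous family: when rung K3 / corner X11a at `3` close, these binders are discharged by `_holds` terms.

* (L_ss) «Miller's lower half `ord₃ #Ш_an ≤ ord₃ #Ш` on every good-SUPERSINGULAR-`3` tower row of analytic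
  rank `0`» (corners X6 / X7 / X8 at `3`):
  §1 `lowerHalf_goodSS_three_of_signedSupersingular` ⟸ the rung-K3 CLOSED LEAF
  `Rank1Residual.Supersingular.SignedSupersingular` (`@[conjecture]`, the target the route `SignedLowerHalves`
  closes) + Wuthrich 2014 Prop. 21 + GZK + modularity (`Supersingular.bsdp_of_signedSupersingular`); a
  tower-surjective curve is non-CM (`not_hasSurjectiveModNGaloisRep_of_hasCM`, Zywina 2015 / Serre 1972, a
  tree theorem at every odd prime) and a good-supersingular-`3` tower row of analytic rank `0` lies in X6
  (`a₃ = 0`, semistable), X7 (`a₃ = 0`, non-semistable) or X8 (`a₃ = ±3`);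
  §1 `lowerHalf_goodSS_three_of_signedLowerHalves_cruxes` ⟸ the route's CRUXES BY NAME —
  `Theses.SignedLowerHalves.KobayashiLowerHalfSemistable` (item 19000, X_B1),
  `….KobayashiLowerHalfLargeImage` (19001, X_B2 large image), `….SprungLowerHalfAtThree` (19003, X_B3) — and
  its support item `….PublishedSignedInputs` (19005), through the tree's class roads
  `X6.bsdp_of_lowerDivisibility`, `X7.bsdp_of_lowerDivisibility_of_surj`,
  `X8.missingInputAt_of_chromaticLowerDivisibility_of_surj` (the small-image crux 19002 and the residual
  19004 are NOT needed on tower-surjective rank-`0` rows).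
* (L_m) «Miller's lower half on every NON-semistable multiplicative-`3` tower row of analytic rank `0`
  WITHOUT (ram)» (corner X11a at `3` off the square-free conductors):
  §2 `lowerHalf_multNotRam_three_of_x11aTargetThree` ⟸ `Rank1Residual.X11a.TargetThree` (cell b2b-bsdres'
  statement of record for the `p = 3` sub-cell of corner X11a: `BSD(E,3)` on every `CellThree` pair) + GZK;
  §2 `lowerHalf_multNotRam_three_of_x11ThreeRankZero` ⟸ the TYPED missing input
  `Typed.X11ThreeRankZero.MissingInputAt` on the X11a-at-`3` pairs (its first clause IS the lower half under
  a surjective `ρ̄_{E,3}`); and the bookkeeping converse §2 `x11aCellThree_of_lowerRow` (an (L_m) row IS an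
  X11a `CellThree` pair with tower-surjective image).
* §3 ★★★★ `stub_nonAdditive_of_rungK3_of_x11aThree_of_tamagawa_le_deepInfty` — the registered stub VERBATIM
  from NINE named published facts, the rung-K3 leaf, corner X11a's `TargetThree`, and (TD) TamDiv-deep on
  the `3 ∣ ∏ c_ℓ` rows (gen 2's ★★ with (L_ss), (L_m) so keyed); ★★★★′ `…_of_signedLowerHalvesCruxes_…` the
  same keyed to the K3 cruxes 19000 / 19001 / 19003 + 19005.
So after this file the residue of `stub_nonAdditive` READS, by name: {rung K3 leaf (or K3 cruxes X_B1,
X_B2-large, X_B3), corner X11a `TargetThree` at `3`, (TD) at depth `v₃(∏ c_ℓ)`} + print — no anonymous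
lower-half family is left on the non-additive rows. HONEST FRAMING: CONDITIONAL theorems; they do not close
item 19679 (landed `--supports`); rung K3 and corner X11a are OPEN (BSTW arXiv:2409.01350 PRE; Sprung 2024
conditional on Conj. 3.33; no (ram)-free integral input at `3 ‖ N` in print); BSD is not proved by any of
this; nothing is booked.

References: [Kobayashi2003] Thm. 1.2, Thm. 4.1; [BDKim2013] Cor. 3.15; [BurungaleKobayashiOta2023] Cor. A.5;
[Sprung2017] Thm. 1.12; [Sprung2024] Lemmas 5.5–5.9; [Wuthrich2014] Prop. 21 (p. 400); [Zywina2015]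
Prop. 1.14/1.16; [Serre1972] §4.5; [Skinner2016PacificMC] Thm. C; [YanZhu2024MainConjNonCM] Thm. 4.15;
[Miller2011LMS] Def. 1.1; [Kim2022StructureSelmer] Conj. 1.10.
-/

set_option autoImplicit false
-- the Theorems namespace of a single-conjunct summit repeats the summit name by design (D-0017)
set_option linter.dupNamespace false

noncomputable section

open scoped MatrixGroups ModularForm Classical

open CongruenceSubgroup WeierstrassCurve Literature.NumberTheory.EllipticCurves
  Literature.NumberTheory.EllipticCurves.ModularForms
  Literature.NumberTheory.EllipticCurves.Rank1Residual
  Literature.NumberTheory.EllipticCurves.Rank1Residual.Typed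
  Literature.NumberTheory.EllipticCurves.Skinner2016
  Literature.NumberTheory.Automorphic
  Summit.BirchSwinnertonDyer.BirchSwinnertonDyer.Theorems.Rank1ResidualX1Defs

namespace Summit.BirchSwinnertonDyer.BirchSwinnertonDyer.Theorems.KimAtThreeDeepLowerOffStratumCornerKeys

open Summit.BirchSwinnertonDyer.Rank1Residual
open Summit.BirchSwinnertonDyer.BirchSwinnertonDyer.Theorems.KimAtThreeDeepLowerOffStratumResidue

/-! ### §1 (L_ss) keyed to rung K3 -/

section RungK3

/-- **(L_ss) ⟸ the rung-K3 closed leaf `SignedSupersingular`** (+ Wuthrich 2014 Prop. 21 `hW`, GZK `hGZK`,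
modularity `hmod`). On a tower-surjective good-supersingular-`3` row of analytic rank `0`: the curve is non-CM
(`not_hasSurjectiveModNGaloisRep_of_hasCM`), the pair lies in corner X6 (`a₃ = 0`, semistable), X7 (`a₃ = 0`,
not semistable) or X8 (`a₃ ≠ 0`), the leaf gives `BSD(E,3)` there (`Supersingular.bsdp_of_signedSupersingular`),
and `BSD(E,3)` gives Miller's lower half (`missingPPartAt_of_bsdp`). CONDITIONAL on the leaf (OPEN).
[cite: Wuthrich2014, Prop. 21 (p. 400)] [cite: Zywina2015, Prop. 1.14 and Prop. 1.16 (§1.9)]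
[cite: Miller2011LMS, Def. 1.1 (arXiv:1010.2431 p. 3)] -/
theorem lowerHalf_goodSS_three_of_signedSupersingular
    (hK3 : Supersingular.SignedSupersingular) (hW : Wuthrich2014.sha_dvd_analyticSha)
    (hGZK : rank_eq_analyticRank_of_analyticRank_le_one) (hmod : hasEntireLFunction_rat) :
    ∀ (W : WeierstrassCurve ℚ) [W.IsElliptic] [W.IsGloballyMinimal],
      (∀ n : ℕ, W.HasSurjectiveModNGaloisRep (3 ^ n : ℕ)) → W.analyticRank = 0 →
      W.HasGoodReductionAtPrime 3 → (3 : ℤ) ∣ W.frobeniusTrace 3 → MissingLowerBoundAt W 3 := by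
  intro W _ _ htower hr0 hgood hss
  haveI : Fact (Nat.Prime 3) := ⟨Nat.prime_three⟩
  have hsurj : Surj W 3 := by simpa [Surj] using htower 1
  have hcm : ¬ W.HasCM := fun hCM ↦
    W.not_hasSurjectiveModNGaloisRep_of_hasCM hCM Nat.prime_three (by decide) hsurj
  have hr : W.analyticRank ≤ 1 := by omega
  haveI : Finite W.sha := (hGZK W hr).2
  obtain ⟨h6, h7, h8⟩ :=
    Supersingular.bsdp_of_signedSupersingular (W := W) (p := 3) hK3 hW hGZK hmod hr hcm (by decide)
  have hGS : GoodSS W 3 := ⟨hgood, hss⟩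
  have hbsd : BSDp W 3 := by
    by_cases ha : W.frobeniusTrace 3 = 0
    · by_cases hsst : Semistable W
      · exact h6 ⟨hGS, hsst, Or.inr ha⟩ hr0
      · exact h7 ⟨hGS, hsst⟩
    · exact h8 ⟨rfl, hGS, ha⟩
  exact (lower_and_upper_of_missingPPartAt W 3 (missingPPartAt_of_bsdp W 3 hbsd)).1

/-- **(L_ss) ⟸ the CRUXES of route `SignedLowerHalves` BY NAME** — `KobayashiLowerHalfSemistable` (item
19000: one-sign Eisenstein half of Kobayashi's main conjecture on X6), `KobayashiLowerHalfLargeImage` (19001: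
the same on X7, non-CM, `a_p = 0`, surjective image), `SprungLowerHalfAtThree` (19003: one-colour ♯/♭ lower
half on X8) — and the support item `PublishedSignedInputs` (19005: Wuthrich Prop. 21, Kobayashi Thm. 1.2 /
4.1, B. D. Kim Cor. 3.15, BKO Cor. A.5, period relations, modularity, GZK), through the class roads
`X6.bsdp_of_lowerDivisibility`, `X7.bsdp_of_lowerDivisibility_of_surj`,
`X8.missingInputAt_of_chromaticLowerDivisibility_of_surj`. The small-image crux (19002) and the X8 residual
(19004) are not needed: the rows are tower-surjective of analytic rank `0`. CONDITIONAL (the three cruxes are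
OPEN). [cite: Kobayashi2003, Thm. 1.2 and Thm. 4.1] [cite: Sprung2017, Thm. 1.12]
[cite: Wuthrich2014, Prop. 21 (p. 400)] [cite: Miller2011LMS, Def. 1.1] -/
theorem lowerHalf_goodSS_three_of_signedLowerHalves_cruxes
    (hB1 : Theses.SignedLowerHalves.KobayashiLowerHalfSemistable)
    (hB2 : Theses.SignedLowerHalves.KobayashiLowerHalfLargeImage)
    (hB3 : Theses.SignedLowerHalves.SprungLowerHalfAtThree)
    (hPub : Theses.SignedLowerHalves.PublishedSignedInputs) :
    ∀ (W : WeierstrassCurve ℚ) [W.IsElliptic] [W.IsGloballyMinimal],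
      (∀ n : ℕ, W.HasSurjectiveModNGaloisRep (3 ^ n : ℕ)) → W.analyticRank = 0 →
      W.HasGoodReductionAtPrime 3 → (3 : ℤ) ∣ W.frobeniusTrace 3 → MissingLowerBoundAt W 3 := by
  intro W _ _ htower hr0 hgood hss
  haveI : Fact (Nat.Prime 3) := ⟨Nat.prime_three⟩
  obtain ⟨hW, h12, h41, hKim, hA5, h5, h3, hmodP, hmod, hGZK⟩ := hPub
  have hsurj : Surj W 3 := by simpa [Surj] using htower 1
  have hcm : ¬ W.HasCM := fun hCM ↦
    W.not_hasSurjectiveModNGaloisRep_of_hasCM hCM Nat.prime_three (by decide) hsurj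
  have hr : W.analyticRank ≤ 1 := by omega
  haveI : Finite W.sha := (hGZK W hr).2
  have hGS : GoodSS W 3 := ⟨hgood, hss⟩
  have lowerOf : BSDp W 3 → MissingLowerBoundAt W 3 := fun h ↦
    (lower_and_upper_of_missingPPartAt W 3 (missingPPartAt_of_bsdp W 3 h)).1
  by_cases ha : W.frobeniusTrace 3 = 0
  · by_cases hsst : Semistable W
    · -- corner X6 at `3`
      have hX : ClassX6 W 3 := ⟨hGS, hsst, Or.inr ha⟩
      obtain ⟨ε, hlow⟩ := hB1 W 3 (by decide) hX
      exact lowerOf (Supersingular.X6.bsdp_of_lowerDivisibility W 3 hW h12 h41 hKim hA5 h5 h3 hmodP hmod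
        hGZK (by decide) hX hr ε hlow)
    · -- corner X7 at `3`, `a₃ = 0`, surjective image
      have hX : ClassX7 W 3 := ⟨hGS, hsst⟩
      obtain ⟨ε, hlow⟩ := hB2 W 3 (by decide) hX hcm ha hsurj
      exact lowerOf (Supersingular.X7.bsdp_of_lowerDivisibility_of_surj W 3 hW h12 h41 hKim hA5 h5 h3 hmodP
        hmod hGZK (by decide) hX ha hsurj hr ε hlow)
  · -- corner X8 (`a₃ = ±3`), rank `0`, surjective image
    have hX : ClassX8 W 3 := ⟨rfl, hGS, ha⟩
    obtain ⟨N, _, f, ϖ, Lsharp, Lflat, c, ξ, hf, hϖ, hSP, hK, hdiv⟩ := hB3 W 3 hX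
    exact (Supersingular.X8.missingInputAt_of_chromaticLowerDivisibility_of_surj W 3 hGZK hmod hX hsurj hr0
      hf hϖ hSP c ξ hK hdiv).1 hr0 (Or.inr hsurj)

end RungK3

/-! ### §2 (L_m) keyed to corner X11a at `3` -/

section CornerX11a

/-- **An (L_m) row IS an X11a `CellThree` pair** (bookkeeping): tower-surjective ⟹ `E[3]` irreducible;
analytic rank `0`, multiplicative `3`, no (ram) witness; `3 ≠ 2`. [folklore] -/
theorem x11aCellThree_of_lowerRow (W : WeierstrassCurve ℚ) [W.IsElliptic] [W.IsGloballyMinimal]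
    (htower : ∀ n : ℕ, W.HasSurjectiveModNGaloisRep (3 ^ n : ℕ)) (hr0 : W.analyticRank = 0)
    (hmult : W.HasMultiplicativeReductionAtPrime 3)
    (hram : ¬ (haveI : Fact (Nat.Prime 3) := ⟨Nat.prime_three⟩; Ram W 3)) :
    (haveI : Fact (Nat.Prime 3) := ⟨Nat.prime_three⟩; X11a.CellThree W 3) := by
  haveI : Fact (Nat.Prime 3) := ⟨Nat.prime_three⟩
  have hirr : W.HasIrreducibleModPGaloisRep 3 :=
    hasIrreducibleModPGaloisRep_of_hasSurjectiveModNGaloisRep W 3 (by simpa using htower 1)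
  exact ⟨⟨hr0, by decide, hmult, hirr, hram⟩, rfl⟩

/-- **(L_m) ⟸ corner X11a's `p = 3` sub-cell target `X11a.TargetThree`** (cell b2b-bsdres' statement of
record: `BSD(E,3)` on every `CellThree` pair — OPEN at class level, no (ram)-free integral input at `3 ‖ N`
in print) + GZK (`Ш` finite). The non-semistability binder of (L_m) is not used (on semistable rows (ram)
is a theorem and the family is empty there — `KimAtThreeDeepLowerOffStratumSemistable`). CONDITIONAL.
[cite: Miller2011LMS, Def. 1.1 (arXiv:1010.2431 p. 3)] [cite: Wuthrich2014, Prop. 21 (p. 400)] -/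
theorem lowerHalf_multNotRam_three_of_x11aTargetThree (hT3 : X11a.TargetThree)
    (hGZK : rank_eq_analyticRank_of_analyticRank_le_one) :
    ∀ (W : WeierstrassCurve ℚ) [W.IsElliptic] [W.IsGloballyMinimal],
      (∀ n : ℕ, W.HasSurjectiveModNGaloisRep (3 ^ n : ℕ)) → W.analyticRank = 0 →
      W.HasMultiplicativeReductionAtPrime 3 → ¬ Semistable W →
      ¬ (haveI : Fact (Nat.Prime 3) := ⟨Nat.prime_three⟩; Ram W 3) → MissingLowerBoundAt W 3 := by
  intro W _ _ htower hr0 hmult _ hram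
  haveI : Fact (Nat.Prime 3) := ⟨Nat.prime_three⟩
  haveI : Finite W.sha := (hGZK W (by omega)).2
  exact (lower_and_upper_of_missingPPartAt W 3 (missingPPartAt_of_bsdp W 3
    (hT3 W 3 (x11aCellThree_of_lowerRow W htower hr0 hmult hram)))).1

/-- **(L_m) ⟸ the TYPED missing input `X11ThreeRankZero.MissingInputAt` on the X11a-at-`3` pairs** (b2b's
typed currency for the rank-`0` multiplicative-`3` (ram)-free rows: under a surjective `ρ̄_{E,3}` the missing
input IS Miller's lower half, Wuthrich's Prop. 21 printing the upper half). Projection of the first clause.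
[cite: Wuthrich2014, Prop. 21 (p. 400)] [cite: Miller2011LMS, Def. 1.1] -/
theorem lowerHalf_multNotRam_three_of_x11ThreeRankZero
    (hX11 : ∀ (W : WeierstrassCurve ℚ) [W.IsElliptic] [W.IsGloballyMinimal],
      (haveI : Fact (Nat.Prime 3) := ⟨Nat.prime_three⟩; X11a.CellThree W 3) →
        X11ThreeRankZero.MissingInputAt W) :
    ∀ (W : WeierstrassCurve ℚ) [W.IsElliptic] [W.IsGloballyMinimal],
      (∀ n : ℕ, W.HasSurjectiveModNGaloisRep (3 ^ n : ℕ)) → W.analyticRank = 0 →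
      W.HasMultiplicativeReductionAtPrime 3 → ¬ Semistable W →
      ¬ (haveI : Fact (Nat.Prime 3) := ⟨Nat.prime_three⟩; Ram W 3) → MissingLowerBoundAt W 3 := by
  intro W _ _ htower hr0 hmult _ hram
  exact (hX11 W (x11aCellThree_of_lowerRow W htower hr0 hmult hram)).1 (by simpa using htower 1)

/-- **Conversely, `X11a.TargetThree` on the NON-semistable tower-surjective pairs ⟸ (L_m)** (+ Wuthrich
2014 Prop. 21 for the upper half, GZK, modularity): on such a pair (L_m) gives the lower half and
`bsdp_of_missingLowerBoundAt_of_wuthrich` the rest. So on these pairs (L_m) and the X11a target agree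
modulo print. [cite: Wuthrich2014, Prop. 21 (p. 400)] [cite: Miller2011LMS, Def. 1.1] -/
theorem x11aTargetThree_nonSemistable_towerSurj_of_lowerRow (hW : Wuthrich2014.sha_dvd_analyticSha)
    (hGZK : rank_eq_analyticRank_of_analyticRank_le_one) (hmod : hasEntireLFunction_rat)
    (hLm : ∀ (W : WeierstrassCurve ℚ) [W.IsElliptic] [W.IsGloballyMinimal],
      (∀ n : ℕ, W.HasSurjectiveModNGaloisRep (3 ^ n : ℕ)) → W.analyticRank = 0 →
      W.HasMultiplicativeReductionAtPrime 3 → ¬ Semistable W →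
      ¬ (haveI : Fact (Nat.Prime 3) := ⟨Nat.prime_three⟩; Ram W 3) → MissingLowerBoundAt W 3)
    (W : WeierstrassCurve ℚ) [W.IsElliptic] [W.IsGloballyMinimal]
    (htower : ∀ n : ℕ, W.HasSurjectiveModNGaloisRep (3 ^ n : ℕ)) (hsst : ¬ Semistable W)
    (hX : (haveI : Fact (Nat.Prime 3) := ⟨Nat.prime_three⟩; X11a.CellThree W 3)) : BSDp W 3 := by
  haveI : Fact (Nat.Prime 3) := ⟨Nat.prime_three⟩
  obtain ⟨⟨hr0, -, hmult, -, hram⟩, -⟩ := hX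
  have hsurj : W.HasSurjectiveModNGaloisRep 3 := by simpa using htower 1
  have hadd : ¬ ((W.baseChange ℚ_[3]).minimal ℤ_[3]).HasAdditiveReduction ℤ_[3] :=
    WeierstrassCurve.HasMultiplicativeReduction.not_hasAdditiveReduction (R := ℤ_[3]) hmult
  exact bsdp_of_missingLowerBoundAt_of_wuthrich W 3 hW hGZK hmod (by decide) hr0 hadd (Or.inr hsurj)
    (hLm W htower hr0 hmult hsst hram)

end CornerX11a

/-! ### §3 The registered stub VERBATIM, residue keyed by name -/

section Stub

/-- ★★★★ **The registered stub `stub_nonAdditive` of crux 19679, VERBATIM, from NINE named published facts,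
the rung-K3 leaf, corner X11a's `p = 3` target, and (TD).** Gen 2's ★★
(`stub_nonAdditive_of_cornerLowerHalves_of_tamagawa_le_deepInfty`) with its two anonymous corner families
discharged BY NAME: (L_ss) ⟸ `Supersingular.SignedSupersingular` (§1), (L_m) ⟸ `X11a.TargetThree` (§2).
Named facts: Yan–Zhu 2026 Thm. 4.15 (`hYZ`, PUB*), Wuthrich 2014 Lemma 20 (`hW20`) and Prop. 21 (`hW`),
Skinner 2016 Thm. C (`hSk`), modularity (`hmod`, `hBCDT`), GZK (`hGZK`), Mazur 1978 Cor. 4.1 (`hM`),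
Ribet 1990 / Diamond 1995 (`hLL`). Displayed: `hK3` (rung K3, OPEN), `hT3` (corner X11a at `3`, OPEN),
`hTD` (TamDiv-deep on the `3 ∣ ∏ c_ℓ` rows). CONDITIONAL; does not close the item.
[cite: YanZhu2024MainConjNonCM, Thm. 4.15 (§4.6)] [cite: Skinner2016PacificMC, Thm. C (§1)]
[cite: Wuthrich2014, Lemma 20 (p. 399), Prop. 21 (p. 400)] [cite: Ribet1990, Thm. 1.1] [cite: Mazur1978, Cor. 4.1]
[cite: Kim2022StructureSelmer, Conj. 1.10 (PDF p. 8)] [cite: Miller2011LMS, Def. 1.1] -/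
theorem stub_nonAdditive_of_rungK3_of_x11aThree_of_tamagawa_le_deepInfty
    (hYZ : YanZhu2026.thm415_padicValRat_bsd_rank_le_one)
    (hW20 : Wuthrich2014.lemma20_surjective_threeAdic_of_semistable)
    (hW : Wuthrich2014.sha_dvd_analyticSha)
    (hSk : Skinner2016.thmC_padicValRat_bsd_rank_zero)
    (hmod : hasEntireLFunction_rat) (hGZK : rank_eq_analyticRank_of_analyticRank_le_one)
    (hM : mazur_not_dvd_maninConstant_of_odd)
    (hBCDT : exists_isNewformOf) (hLL : diamond1995_refinedSerre)
    (hK3 : Supersingular.SignedSupersingular) (hT3 : X11a.TargetThree)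
    (hTD : ∀ (W : WeierstrassCurve ℚ) [W.IsElliptic] [W.IsGloballyMinimal],
      (∀ n : ℕ, W.HasSurjectiveModNGaloisRep (3 ^ n : ℕ)) →
      ∀ {N : ℕ} [NeZero N] (f : CuspForm (Gamma0 N) 2), IsNewformOf W f →
      kuriharaVanishingOrder W 3 f = 0 →
      ¬ (haveI : Fact (Nat.Prime 3) := ⟨Nat.prime_three⟩; Addv W 3) → 3 ∣ W.tamagawaProduct →
        ((padicValNat 3 W.tamagawaProduct : ℕ) : ℕ∞) ≤ kuriharaPartialDeepInfty W 3 f) :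
    ∀ (W₀ : WeierstrassCurve ℚ) [W₀.IsElliptic] [W₀.IsGloballyMinimal],
      (∀ n : ℕ, W₀.HasSurjectiveModNGaloisRep (3 ^ n : ℕ)) → Finite W₀.sha →
      ∀ {N : ℕ} [NeZero N], N = W₀.conductorNorm ℤ →
      ∀ (D₀ : ModularParametrizationData W₀ N),
        (∀ z ∈ D₀.L.lattice, ∃ w ∈ periodLattice D₀.f, z = D₀.c * w) →
        (∀ (W₂ : WeierstrassCurve ℚ) [W₂.IsElliptic] (D₂ : ModularParametrizationData W₂ N),
          D₂.f = D₀.f → D₀.modularDegree ≤ D₂.modularDegree) →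
        (∀ r : ℚ, ratPlusSymbol D₀.f r ≠ 0 → 0 ≤ padicValRat 3 (ratPlusSymbol D₀.f r)) →
        kuriharaVanishingOrder W₀ 3 D₀.f = 0 →
        ¬ (haveI : Fact (Nat.Prime 3) := ⟨Nat.prime_three⟩; Addv W₀ 3) →
        ∃ d : ℕ, kuriharaPartialDeepInfty W₀ 3 D₀.f = d ∧
          kuriharaPartial W₀ 3 D₀.f 0 ≤
            ((padicValNat 3 (Nat.card (AddCommGroup.primaryComponent W₀.sha 3)) + d : ℕ) : ℕ∞) :=
  stub_nonAdditive_of_cornerLowerHalves_of_tamagawa_le_deepInfty hYZ hW20 hSk hmod hGZK hM hBCDT hLL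
    (lowerHalf_goodSS_three_of_signedSupersingular hK3 hW hGZK hmod)
    (lowerHalf_multNotRam_three_of_x11aTargetThree hT3 hGZK) hTD

/-- ★★★★′ **The same keyed to the K3 CRUXES** (items 19000 / 19001 / 19003 of route `SignedLowerHalves`
+ its support item 19005 `PublishedSignedInputs`, which also carries modularity and GZK) and to corner
X11a's `TargetThree`. CONDITIONAL; does not close the item. [cite: Kobayashi2003, Thm. 1.2 and Thm. 4.1]
[cite: Sprung2017, Thm. 1.12] [cite: YanZhu2024MainConjNonCM, Thm. 4.15 (§4.6)] [cite: Skinner2016PacificMC, Thm. C (§1)]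
[cite: Ribet1990, Thm. 1.1] [cite: Mazur1978, Cor. 4.1] [cite: Miller2011LMS, Def. 1.1] -/
theorem stub_nonAdditive_of_signedLowerHalvesCruxes_of_x11aThree_of_tamagawa_le_deepInfty
    (hYZ : YanZhu2026.thm415_padicValRat_bsd_rank_le_one)
    (hW20 : Wuthrich2014.lemma20_surjective_threeAdic_of_semistable)
    (hSk : Skinner2016.thmC_padicValRat_bsd_rank_zero)
    (hM : mazur_not_dvd_maninConstant_of_odd)
    (hBCDT : exists_isNewformOf) (hLL : diamond1995_refinedSerre)
    (hB1 : Theses.SignedLowerHalves.KobayashiLowerHalfSemistable)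
    (hB2 : Theses.SignedLowerHalves.KobayashiLowerHalfLargeImage)
    (hB3 : Theses.SignedLowerHalves.SprungLowerHalfAtThree)
    (hPub : Theses.SignedLowerHalves.PublishedSignedInputs) (hT3 : X11a.TargetThree)
    (hTD : ∀ (W : WeierstrassCurve ℚ) [W.IsElliptic] [W.IsGloballyMinimal],
      (∀ n : ℕ, W.HasSurjectiveModNGaloisRep (3 ^ n : ℕ)) →
      ∀ {N : ℕ} [NeZero N] (f : CuspForm (Gamma0 N) 2), IsNewformOf W f →
      kuriharaVanishingOrder W 3 f = 0 →
      ¬ (haveI : Fact (Nat.Prime 3) := ⟨Nat.prime_three⟩; Addv W 3) → 3 ∣ W.tamagawaProduct →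
        ((padicValNat 3 W.tamagawaProduct : ℕ) : ℕ∞) ≤ kuriharaPartialDeepInfty W 3 f) :
    ∀ (W₀ : WeierstrassCurve ℚ) [W₀.IsElliptic] [W₀.IsGloballyMinimal],
      (∀ n : ℕ, W₀.HasSurjectiveModNGaloisRep (3 ^ n : ℕ)) → Finite W₀.sha →
      ∀ {N : ℕ} [NeZero N], N = W₀.conductorNorm ℤ →
      ∀ (D₀ : ModularParametrizationData W₀ N),
        (∀ z ∈ D₀.L.lattice, ∃ w ∈ periodLattice D₀.f, z = D₀.c * w) →
        (∀ (W₂ : WeierstrassCurve ℚ) [W₂.IsElliptic] (D₂ : ModularParametrizationData W₂ N),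
          D₂.f = D₀.f → D₀.modularDegree ≤ D₂.modularDegree) →
        (∀ r : ℚ, ratPlusSymbol D₀.f r ≠ 0 → 0 ≤ padicValRat 3 (ratPlusSymbol D₀.f r)) →
        kuriharaVanishingOrder W₀ 3 D₀.f = 0 →
        ¬ (haveI : Fact (Nat.Prime 3) := ⟨Nat.prime_three⟩; Addv W₀ 3) →
        ∃ d : ℕ, kuriharaPartialDeepInfty W₀ 3 D₀.f = d ∧
          kuriharaPartial W₀ 3 D₀.f 0 ≤
            ((padicValNat 3 (Nat.card (AddCommGroup.primaryComponent W₀.sha 3)) + d : ℕ) : ℕ∞) :=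
  stub_nonAdditive_of_cornerLowerHalves_of_tamagawa_le_deepInfty hYZ hW20 hSk hPub.2.2.2.2.2.2.2.2.1
    hPub.2.2.2.2.2.2.2.2.2 hM hBCDT hLL
    (lowerHalf_goodSS_three_of_signedLowerHalves_cruxes hB1 hB2 hB3 hPub)
    (lowerHalf_multNotRam_three_of_x11aTargetThree hT3 hPub.2.2.2.2.2.2.2.2.2) hTD

end Stub

end Summit.BirchSwinnertonDyer.BirchSwinnertonDyer.Theorems.KimAtThreeDeepLowerOffStratumCornerKeys

end
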